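import Summits.QuantumFields.BalabanUV.Beta.MultiscaleSupMemberBallDirichlet
import Summits.QuantumFields.BalabanUV.Beta.MultiscaleRegularityClosed

/-!
# Beta / MultiscaleSupMemberDirichlet — files 9b∕17 FOR THE LOCAL DIRICHLET INVERSES: the SUP-NORM member (3.42)₁'s SHAPE for
# `G′ = dirInv (levelOp) χ` at INTERIOR points of the domain (the `d_n`-ball of radius `ρ₀` about the evaluation site lies in `{χ = 1}`),
# sitewise, level-free, uniformly in the domain — «9b-Dirichlet» modulo `hreg`, and «17-Dirichlet» HYPOTHESIS-FREE with the owner's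
# `hreg_holds`; the second brick of the LOCAL sup member for the level-free WRS-currency parametrix (w4-d)∕(w4-f) (MODEL)

WHAT IS CERTIFIED (kernel, 0 sorry).  Setting of `MultiscaleDecay.hc_levelOp` (isometric `Rm`, `T`; (P); cell-sum coercivity; `0 ≤ κ ≤ 1`;
margin `μ₀ > 0`), graded sides with the sitewise additive datum, `(1+d/2)log L/R ≤ κ`, ANY {0,1}-valued `χ`:
* **`real_sup_dirInv_le_of_regularity`** — file 9b VERBATIM for `G′`: under the local-regularity datum `hreg` (radius `ρ₀`) and the
  interiority clause `d_n(q,p) ≤ ρ₀ ⟹ χ q = 1`, for `u` supported in cell `k′` with `|u| ≤ m`: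
  `|(G′u)(p)| ≤ (c₁K₁′ + c₂K₂)·n(x)²·e^{−(κ − (1+d/2)log L/R)·d_n(x,t_{k′})}·m` with `K₁′ = K₁·μ₀∕min(μ₀,1)` (9a-Dirichlet's profile);
* **`real_sup_dirInv_le`** — the same with a CONSTANT bond weight `c ≡ c₀ ≠ 0` and `hreg` DISCHARGED by the owner's file 17
  `MultiscaleRegularityClosed.hreg_holds` (`ρ₀ = 4d + 1`): NO binder — the local propagators `G′_□` of the parametrix obey (3.42)₁'s shape at
  every site whose `(4d+1)`-ball in `d_n` stays inside `□`, with constants seeing `d, c₀, c_max, a_max, C, κ, L, A, R, |Cp|` ONLY.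
(unit `b2b-balaban-beta-d4-p2`, GEN 11, MODEL crew; journal l.23681 ff.; boundary points: DG6's zero-extension route, separate.)

HONEST FRAMING: discharging `BetaPertH` makes Bałaban's UV stability UNCONDITIONAL — NOT the continuum limit, NOT the Clay problem.
HONEST DEPENDENCY (verbatim): «continuum YM on T⁴ ⇐ BetaPertH ∧ nine spine estimates (0/9 proved); BetaPertH ⇐ (D1) ∧ (D4) ∧ CAP+tail;
G-an2-4 gates asym, D1 and NE2/3/4.»  THIS MODULE DISCHARGES NOTHING of `BetaPertH`, asserts NOTHING printed and cites nothing as a fact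
(ABSOLUTE RULE): [folklore] finite-dimensional bookkeeping about the MODEL operator; nothing of Bałaban's G′(U)∕G′_□ — (3.42)∕(3.86)–(3.88)
are LOCI.  No class change on row D4 (critical-path width 0; D4 DISCHARGE NO DATE); NOT BetaPertH, NOT continuum, NOT Clay, NOT summit progress.
-/

open scoped BigOperators
open Finset

namespace Summit.QuantumFields.BalabanUV.Beta.MultiscaleSupMemberDirichlet

open Summit.QuantumFields.BalabanUV.Beta.MultiscaleCombesThomasL2CellsGraded (siteScale_ctrU)
open Summit.QuantumFields.BalabanUV.Beta.BoxPoincare (Box)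
open Summit.QuantumFields.BalabanUV.Beta.MultiscaleCoerciveTorus
open Summit.QuantumFields.BalabanUV.Beta.MultiscaleDistance
open Summit.QuantumFields.BalabanUV.Beta.MultiscaleDistanceGraded (scale_le_scale_mul_exp_add)
open Summit.QuantumFields.BalabanUV.Beta.MultiscaleDistanceMetric (sdist_comm sdist_triangle_torus)
open Summit.QuantumFields.BalabanUV.Beta.MultiscaleDecayBudget
open Summit.QuantumFields.BalabanUV.Beta.AccretiveCombesThomasSandwichSite (sdist_corner_thresholds)
open Summit.QuantumFields.BalabanUV.Beta.MultiscaleSupMemberBall (scale_pow_le sqrt_mul_pow cell_norm_le_of_abs_le)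
open Summit.QuantumFields.BalabanUV.Beta.MultiscaleSupMemberBallDirichlet (real_ballNorm_dirInv_le levelOp_dirInv_apply_of_mem
  coer_pos_of_margin)
open Summit.QuantumFields.BalabanUV.Beta.MultiscaleRegularityClosed (hreg_holds)
open Summit.QuantumFields.BalabanUV.Beta.SubsolutionMeanValueBox (Cmv)
open Literature.MathematicalPhysics.QuantumFieldTheory.Balaban1983to89
open Literature.MathematicalPhysics.QuantumFieldTheory.Balaban1983to89.B9Thm37GluePU (bsrc btgt)
open Literature.MathematicalPhysics.QuantumFieldTheory.Balaban1983to89.B9Thm37GlueTorusInv (dirInv)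
open Literature.MathematicalPhysics.QuantumFieldTheory.Balaban1983to89.B9Thm37GlueTorusCov (tblk)
open Literature.MathematicalPhysics.QuantumFieldTheory.Balaban1983to89.B9Thm37GlueTorusCovLevels (levelOp)
open B5TorusCover (UT Ctr ctrU)

noncomputable section

variable {d : ℕ} {N : Fin d → ℕ} [∀ i, NeZero (N i)] [NeZero d] {Cp J K : Type} [Fintype Cp] [DecidableEq Cp] [Nonempty Cp]
  [Fintype J] [Fintype K] [DecidableEq K] (S : J → ℕ) (hS : ∀ l, 1 ≤ S l) (hdivS : ∀ l i, S l ∣ N i) (lvl : K → J)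
  (zc : (k : K) → Ctr N (S (lvl k)))

/-! ## The analytic setting of `MultiscaleDecay.hc_levelOp`, as section variables (as in files 7∕8 and K4 §6) -/

variable
    (hdisj : ∀ k k' v v', cellPt S hS hdivS lvl zc k v = cellPt S hS hdivS lvl zc k' v' → k = k')
    (hcover : ∀ x : UT N, ∃ k, ∃ v : Box d (S (lvl k)), cellPt S hS hdivS lvl zc k v = x)
    (Rm : UT N × Fin d → Cp → Cp → ℝ) (hRm : ∀ b i j, ∑ k, Rm b k i * Rm b k j = if i = j then (1 : ℝ) else 0)
    (T : J → UT N → Cp → Cp → ℝ) (hT : ∀ l x i i', ∑ k, T l x k i * T l x k i' = if i = i' then (1 : ℝ) else 0)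
    (a : J → ℝ) (ha : ∀ j, 0 ≤ a j) (ω : J → UT N → ℝ)
    (hsupp : ∀ l x, ω l (ctrU N (S l) (tblk (hS l) (hdivS l) x)) ≠ 0 → ∃ k v, lvl k = l ∧ cellPt S hS hdivS lvl zc k v = x)
    {amax : ℝ} (hamax : 0 ≤ amax)
    (hscale : ∀ k, a (lvl k) * ω (lvl k) (ctrU N (S (lvl k)) (zc k)) ^ 2 * (S (lvl k) : ℝ) ^ d ≤ amax / (S (lvl k) : ℝ) ^ 2)
    (c : UT N × Fin d → ℝ) {cmax : ℝ} (hc : ∀ b, |c b| ≤ cmax) {C : ℝ}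
    (hcoer : ∀ f : UT N × Cp → ℝ,
      C * ∑ k, ((S (lvl k) : ℝ) ^ 2)⁻¹ * ∑ v : Box d (S (lvl k)), ∑ i, f (cellPt S hS hdivS lvl zc k v, i) ^ 2 ≤
        ∑ p, f p * levelOp bsrc btgt c Rm (fun l x => ctrU N (S l) (tblk (hS l) (hdivS l) x))
          (fun l x => ω l (ctrU N (S l) (tblk (hS l) (hdivS l) x))) T a f p)
    {κ : ℝ} (hκ0 : 0 ≤ κ) (hκ1 : κ ≤ 1)

include hdisj hRm hT ha hsupp hamax hscale hc hcoer hκ0 hκ1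

/-! ## §1 File 9b for the Dirichlet inverses at interior points -/

/-- **THE SUP-NORM MEMBER'S SHAPE FOR THE LOCAL DIRICHLET INVERSES `dirInv (levelOp) χ` AT INTERIOR POINTS, FROM THE LOCAL-REGULARITY DATUM** (file 9b's statement and proof with `(levelOp)⁻¹ ↦ G′ = dirInv (levelOp) χ`, `μ₀ ↦ min(μ₀,1)`, and the interiority clause «the `d_n`-ball of radius `ρ₀` about `p` lies in the domain», on which `levelOp (G′u) = u` — so `hreg` applies verbatim).  ORIGINAL DOCSTRING OF 9b:  MODEL setting of `hc_levelOp`;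
graded level sides `S_l = L^{e_l}` (`1 ≤ L`, `0 < R`) with the sitewise additive datum; the rate condition
`(1 + d/2)·(log L/R) ≤ κ`; and the LOCAL-REGULARITY DATUM `hreg` with constants `c₁, c₂ ≥ 0` and radius `ρ₀`:
for every field `f`, site `p` and `m′`, if `|(levelOp f)(q)| ≤ m′` for all `q` with `d_n(q,p) ≤ ρ₀`, then
`|f(p)| ≤ c₁·√(n(p)^{−d}·Σ_{d_n(q,p) ≤ ρ₀} f(q)²) + c₂·n(p)²·m′` (O.2 item (ii-b) as ONE binder — a HYPOTHESIS, not a cited fact).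
Then for `u` supported in cell `k′` with `|u| ≤ m` and every `p = (x,i)`:
`|((levelOp)⁻¹u)(p)| ≤ (c₁·K₁ + c₂·K₂)·n(x)²·e^{−(κ − (1 + d/2)·log L/R)·d_n(x,t_{k′})}·m`, with
`K₁ = √|Cp|·e^{κ(ρ₀+2d)}·(L^A e^{(log L/R)ρ₀})·L^A·√((L^A)^d)/μ₀`, `K₂ = e^{(κ − (1+d/2)·log L/R)(ρ₀ + 2d)}` — print's
«|(G′(U)λ)(x)| ≦ B₀(L^jη)²e^{−δ₀d(y,y′)}|λ|» SHAPE with `n(x)²` the squared LOCAL scale at the evaluation site, constants seeing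
`d, c, a, C, κ, L, A, R, ρ₀, c₁, c₂, |Cp|` only.  Proof: §3 on the ball around `x` + `cell_norm_le_of_abs_le` + the graded exchanges
(§1 and `scale_le_scale_mul_exp_add` at `(x, t_{k′})`) for the first term of `hreg`; for the second, `m′ = m` if the ball meets
cell `k′` (then `d_n(x,t_{k′}) ≤ ρ₀ + 2d`), else `m′ = 0`.
[cite: Balaban1985BackgroundPropagators, Thm 3.1 (3.42) p.397; Balaban1983RegularityDecay, Lemma 2.2 (2.17) p.577; Balaban1984PropagatorsII, Prop. 2.2 (2.67) p.234] [folklore] -/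
theorem real_sup_dirInv_le_of_regularity
    (hμ : 0 < C - 2 * d * cmax ^ 2 * κ ^ 2 - amax * (Real.exp (2 * d * κ) - 1))
    {L : ℕ} (hL : 1 ≤ L) (e : J → ℕ) (hSe : ∀ l, S l = L ^ e l) {R : ℝ} (hR : 0 < R) {A : ℕ}
    (hadd : ∀ x y : UT N, |(e (lvl (cellOf S hS hdivS lvl zc hcover x)) : ℝ) - e (lvl (cellOf S hS hdivS lvl zc hcover y))| ≤
      A + sdist bsrc btgt (siteScale S hS hdivS lvl zc hcover) x y / R)
    (hrate : (1 + d / 2) * (Real.log L / R) ≤ κ)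
    {c₁ c₂ ρ₀ : ℝ} (hc₁ : 0 ≤ c₁) (hc₂ : 0 ≤ c₂)
    (hreg : ∀ (f : UT N × Cp → ℝ) (p : UT N × Cp) (m' : ℝ),
      (∀ q : UT N × Cp, sdist bsrc btgt (siteScale S hS hdivS lvl zc hcover) q.1 p.1 ≤ ρ₀ →
        |levelOp bsrc btgt c Rm (fun l x => ctrU N (S l) (tblk (hS l) (hdivS l) x))
          (fun l x => ω l (ctrU N (S l) (tblk (hS l) (hdivS l) x))) T a f q| ≤ m') →
      |f p| ≤ c₁ * Real.sqrt (((siteScale S hS hdivS lvl zc hcover p.1 : ℝ) ^ d)⁻¹ *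
          ∑ q ∈ univ.filter (fun q : UT N × Cp => sdist bsrc btgt (siteScale S hS hdivS lvl zc hcover) q.1 p.1 ≤ ρ₀), f q ^ 2) +
        c₂ * (siteScale S hS hdivS lvl zc hcover p.1 : ℝ) ^ 2 * m')
    (χ : UT N × Cp → ℝ) (hχ : ∀ p, χ p = 0 ∨ χ p = 1)
    (k' : K) (u : UT N × Cp → ℝ) (hu : ∀ p, cellOf S hS hdivS lvl zc hcover p.1 ≠ k' → u p = 0)
    {m : ℝ} (hm : 0 ≤ m) (hum : ∀ p, |u p| ≤ m) (p : UT N × Cp)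
    (hint : ∀ q : UT N × Cp, sdist bsrc btgt (siteScale S hS hdivS lvl zc hcover) q.1 p.1 ≤ ρ₀ → χ q = 1) :
    |(dirInv (levelOp bsrc btgt c Rm (fun l x => ctrU N (S l) (tblk (hS l) (hdivS l) x))
        (fun l x => ω l (ctrU N (S l) (tblk (hS l) (hdivS l) x))) T a) χ) u p| ≤
      (c₁ * (Real.sqrt (Fintype.card Cp) * Real.exp (κ * (ρ₀ + 2 * d)) *
            ((L : ℝ) ^ A * Real.exp (Real.log L / R * ρ₀)) * (L : ℝ) ^ A * Real.sqrt (((L : ℝ) ^ A) ^ d) /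
            min (C - 2 * d * cmax ^ 2 * κ ^ 2 - amax * (Real.exp (2 * d * κ) - 1)) 1) +
          c₂ * Real.exp ((κ - (1 + d / 2) * (Real.log L / R)) * (ρ₀ + 2 * d))) *
        (siteScale S hS hdivS lvl zc hcover p.1 : ℝ) ^ 2 *
        Real.exp (-((κ - (1 + d / 2) * (Real.log L / R)) *
          sdist bsrc btgt (siteScale S hS hdivS lvl zc hcover) p.1 (ctrU N (S (lvl k')) (zc k')))) * m := by
  classical
  -- the datum at our field and site, for the two values of `m′` used below (instantiated BEFORE the abbreviations)
  have hregm := hreg ((dirInv (levelOp bsrc btgt c Rm (fun l x => ctrU N (S l) (tblk (hS l) (hdivS l) x))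
    (fun l x => ω l (ctrU N (S l) (tblk (hS l) (hdivS l) x))) T a) χ) u) p m
  have hreg0 := hreg ((dirInv (levelOp bsrc btgt c Rm (fun l x => ctrU N (S l) (tblk (hS l) (hdivS l) x))
    (fun l x => ω l (ctrU N (S l) (tblk (hS l) (hdivS l) x))) T a) χ) u) p 0
  set μ₀ := C - 2 * d * cmax ^ 2 * κ ^ 2 - amax * (Real.exp (2 * d * κ) - 1) with hμ₀
  set m₀ := min μ₀ 1 with hm₀def
  have hm0 : 0 < m₀ := lt_min hμ zero_lt_one
  set Aop := levelOp bsrc btgt c Rm (fun l x => ctrU N (S l) (tblk (hS l) (hdivS l) x))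
    (fun l x => ω l (ctrU N (S l) (tblk (hS l) (hdivS l) x))) T a with hAop
  set n := siteScale S hS hdivS lvl zc hcover with hn
  set tk' : UT N := ctrU N (S (lvl k')) (zc k') with htk'
  set t : ℝ := Real.log L / R with ht
  set Γ : ℝ := (L : ℝ) ^ A * Real.exp (t * ρ₀) with hΓ
  set x := p.1 with hx
  set D : ℝ := sdist bsrc btgt n x tk' with hD
  set f := (dirInv Aop χ) u with hf
  set Bll := univ.filter (fun q : UT N × Cp => sdist bsrc btgt n q.1 x ≤ ρ₀) with hBll
  set Src := univ.filter (fun q : UT N × Cp => cellOf S hS hdivS lvl zc hcover q.1 = k') with hSrc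
  obtain ⟨i₀⟩ := ‹Nonempty Cp›
  have hL0 : (0 : ℝ) < L := by exact_mod_cast hL
  have hLA : (1 : ℝ) ≤ (L : ℝ) ^ A := one_le_pow₀ (by exact_mod_cast hL)
  have hΓpos : 0 < Γ := mul_pos (pow_pos hL0 A) (Real.exp_pos _)
  have ht0 : 0 ≤ t := div_nonneg (Real.log_nonneg (by exact_mod_cast hL)) hR.le
  have hSpos : ∀ l, (0 : ℝ) < (S l : ℝ) := fun l => by exact_mod_cast hS l
  have hnpos : ∀ y, (0 : ℝ) < (n y : ℝ) := fun y => by exact_mod_cast one_le_siteScale S hS hdivS lvl zc hcover y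
  -- `A f = u` ON THE DOMAIN
  have hAf : ∀ q, χ q = 1 → Aop f q = u q := fun q hq =>
    levelOp_dirInv_apply_of_mem S hS hdivS lvl zc hdisj hcover Rm T a ω c (coer_pos_of_margin hamax hκ0 hμ) hcoer χ hχ u q hq
  -- the grading and the two corners
  have hgr : ∀ y, n y = L ^ (e (lvl (cellOf S hS hdivS lvl zc hcover y))) := fun y => by rw [hn, siteScale, hSe]
  have hk' : cellOf S hS hdivS lvl zc hcover tk' = k' := by
    rw [htk', ← cubePt_zero (hS (lvl k')) (hdivS (lvl k')) (zc k')]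
    exact cellOf_cellPt S hS hdivS lvl zc hdisj hcover k' _
  have hntk' : (n tk' : ℝ) = S (lvl k') := by rw [hn, htk', siteScale_ctrU S hS hdivS lvl zc hdisj hcover k']
  -- §3: the ℓ² bound on the ball
  have hball := real_ballNorm_dirInv_le S hS hdivS lvl zc hdisj hcover Rm hRm T hT a ha ω hsupp hamax hscale c hc hcoer
    hκ0 hκ1 hμ hL e hSe hR hadd χ hχ k' u hu x ρ₀
  -- simplify its prefactor: `√((μ₀(Γn)⁻²)(μ₀S′⁻²)) = μ₀/(Γ n S′)`
  have hsq : Real.sqrt (m₀ * ((Γ * (n x : ℝ)) ^ 2)⁻¹ * (m₀ * ((S (lvl k') : ℝ) ^ 2)⁻¹)) = m₀ / (Γ * n x * S (lvl k')) := by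
    have hpos : 0 < Γ * n x * S (lvl k') := mul_pos (mul_pos hΓpos (hnpos x)) (hSpos (lvl k'))
    have : m₀ * ((Γ * (n x : ℝ)) ^ 2)⁻¹ * (m₀ * ((S (lvl k') : ℝ) ^ 2)⁻¹) = (m₀ / (Γ * n x * S (lvl k'))) ^ 2 := by
      field_simp
    rw [this, Real.sqrt_sq (div_nonneg hm0.le hpos.le)]
  have hexp1 : Real.exp (-(κ * ((D - ρ₀) - 2 * d))) = Real.exp (κ * (ρ₀ + 2 * d)) * Real.exp (-(κ * D)) := by
    rw [← Real.exp_add]; congr 1; ring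
  -- the source norm
  have hsrc := cell_norm_le_of_abs_le S hS hdivS lvl zc hcover k' u hm hum
  -- the ℓ² bound in closed form: `‖1_B f‖ ≤ e^{κ(ρ₀+2d)} e^{−κD} Γ n S′/μ₀ · √(S′^d|Cp|)·m`
  have hB : Real.sqrt (∑ q ∈ Bll, f q ^ 2) ≤
      Real.exp (κ * (ρ₀ + 2 * d)) * Real.exp (-(κ * D)) * (Γ * n x * S (lvl k') / m₀) *
        (Real.sqrt ((S (lvl k') : ℝ) ^ d * Fintype.card Cp) * m) := by
    have h1 : Real.sqrt (∑ q ∈ Bll, f q ^ 2) ≤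
        Real.exp (-(κ * ((D - ρ₀) - 2 * d))) / Real.sqrt (m₀ * ((Γ * (n x : ℝ)) ^ 2)⁻¹ * (m₀ * ((S (lvl k') : ℝ) ^ 2)⁻¹)) *
          Real.sqrt (∑ q ∈ Src, u q ^ 2) := by
      have := hball
      simpa only [hBll, hSrc, hf, hAop, hn, hD, htk', hΓ, ht, mul_pow] using this
    rw [hsq, hexp1] at h1
    refine h1.trans ?_
    have hpre : 0 ≤ Real.exp (κ * (ρ₀ + 2 * d)) * Real.exp (-(κ * D)) / (m₀ / (Γ * n x * S (lvl k'))) :=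
      div_nonneg (mul_nonneg (Real.exp_pos _).le (Real.exp_pos _).le)
        (div_nonneg hm0.le (mul_nonneg (mul_nonneg hΓpos.le (hnpos x).le) (hSpos _).le))
    calc Real.exp (κ * (ρ₀ + 2 * d)) * Real.exp (-(κ * D)) / (m₀ / (Γ * n x * S (lvl k'))) * Real.sqrt (∑ q ∈ Src, u q ^ 2)
        ≤ Real.exp (κ * (ρ₀ + 2 * d)) * Real.exp (-(κ * D)) / (m₀ / (Γ * n x * S (lvl k'))) *
            (Real.sqrt ((S (lvl k') : ℝ) ^ d * Fintype.card Cp) * m) := mul_le_mul_of_nonneg_left hsrc hpre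
      _ = _ := by
        have hμne : m₀ ≠ 0 := hm0.ne'
        field_simp
  -- the graded exchanges at `(x, t_{k′})`: `S′ ≤ L^A·n(x)·e^{tD}` and `S′^d ≤ (L^A e^{tD} n(x))^d`
  have hnx := hnpos x
  have hS1 : (S (lvl k') : ℝ) ≤ (L : ℝ) ^ A * n x * Real.exp (t * D) := by
    have h := scale_le_scale_mul_exp_add bsrc btgt n hL (fun y => e (lvl (cellOf S hS hdivS lvl zc hcover y))) hgr
      (A := A) (hadd x tk')
    rw [hntk'] at h
    simpa only [← ht, ← hD] using h
  have hpow : ((S (lvl k') : ℝ)) ^ d ≤ ((L : ℝ) ^ A * Real.exp (t * D) * n x) ^ d := by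
    have h := scale_pow_le bsrc btgt n hL (fun y => e (lvl (cellOf S hS hdivS lvl zc hcover y))) hgr d (A := A) (hadd x tk')
    rw [hntk'] at h
    simpa only [← ht, ← hD] using h
  -- the volume ratio: `√(n(x)^{-d})·√(S′^d·|Cp|) ≤ √|Cp|·√((L^A)^d)·e^{(d/2)tD}`
  have hratio : Real.sqrt ((((n x : ℝ)) ^ d)⁻¹) * Real.sqrt (((S (lvl k') : ℝ)) ^ d * Fintype.card Cp) ≤
      Real.sqrt (Fintype.card Cp) * Real.sqrt (((L : ℝ) ^ A) ^ d) * Real.exp (d / 2 * (t * D)) := by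
    have hnd : (0 : ℝ) < (n x : ℝ) ^ d := pow_pos hnx d
    have h1 : (((n x : ℝ)) ^ d)⁻¹ * (((S (lvl k') : ℝ)) ^ d * Fintype.card Cp) ≤
        ((L : ℝ) ^ A * Real.exp (t * D)) ^ d * Fintype.card Cp := by
      rw [inv_mul_le_iff₀ hnd]
      calc ((S (lvl k') : ℝ)) ^ d * (Fintype.card Cp : ℝ)
          ≤ ((L : ℝ) ^ A * Real.exp (t * D) * n x) ^ d * Fintype.card Cp :=
            mul_le_mul_of_nonneg_right hpow (Nat.cast_nonneg _)
        _ = (n x : ℝ) ^ d * (((L : ℝ) ^ A * Real.exp (t * D)) ^ d * Fintype.card Cp) := by ring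
    have hdt : (d : ℝ) * (t * D) / 2 = d / 2 * (t * D) := by ring
    calc Real.sqrt ((((n x : ℝ)) ^ d)⁻¹) * Real.sqrt (((S (lvl k') : ℝ)) ^ d * Fintype.card Cp)
        = Real.sqrt ((((n x : ℝ)) ^ d)⁻¹ * (((S (lvl k') : ℝ)) ^ d * Fintype.card Cp)) :=
          (Real.sqrt_mul (inv_nonneg.mpr hnd.le) _).symm
      _ ≤ Real.sqrt (((L : ℝ) ^ A * Real.exp (t * D)) ^ d * Fintype.card Cp) := Real.sqrt_le_sqrt h1
      _ = Real.sqrt (((L : ℝ) ^ A) ^ d) * Real.sqrt (Real.exp (t * D) ^ d) * Real.sqrt (Fintype.card Cp) := by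
          rw [Real.sqrt_mul (by positivity), sqrt_mul_pow (by positivity)]
      _ = Real.sqrt (Fintype.card Cp) * Real.sqrt (((L : ℝ) ^ A) ^ d) * Real.exp (d / 2 * (t * D)) := by
          have hse : Real.sqrt (Real.exp (d * (t * D))) = Real.exp (d * (t * D) / 2) := by
            rw [show Real.exp (d * (t * D)) = Real.exp (d * (t * D) / 2) ^ 2 by
              rw [← Real.exp_nat_mul]; congr 1; ring]
            exact Real.sqrt_sq (Real.exp_pos _).le
          rw [← Real.exp_nat_mul, hse, hdt]; ring
  have hexp2 : Real.exp (-(κ * D)) * Real.exp (t * D) * Real.exp (d / 2 * (t * D)) =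
      Real.exp (-((κ - (1 + d / 2) * t) * D)) := by
    rw [← Real.exp_add, ← Real.exp_add]; congr 1; ring
  -- THE FIRST TERM OF THE DATUM
  have hfirst : c₁ * Real.sqrt ((((n x : ℝ)) ^ d)⁻¹ * ∑ q ∈ Bll, f q ^ 2) ≤
      c₁ * (Real.sqrt (Fintype.card Cp) * Real.exp (κ * (ρ₀ + 2 * d)) * Γ * (L : ℝ) ^ A * Real.sqrt (((L : ℝ) ^ A) ^ d) / m₀) *
        (n x : ℝ) ^ 2 * Real.exp (-((κ - (1 + d / 2) * t) * D)) * m := by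
    have hpre0 : 0 ≤ Real.exp (κ * (ρ₀ + 2 * d)) * Real.exp (-(κ * D)) * Γ * n x / m₀ * m := by positivity
    have step3 : (S (lvl k') : ℝ) * (Real.sqrt ((((n x : ℝ)) ^ d)⁻¹) * Real.sqrt (((S (lvl k') : ℝ)) ^ d * Fintype.card Cp)) ≤
        ((L : ℝ) ^ A * n x * Real.exp (t * D)) *
          (Real.sqrt (Fintype.card Cp) * Real.sqrt (((L : ℝ) ^ A) ^ d) * Real.exp (d / 2 * (t * D))) :=
      mul_le_mul hS1 hratio (mul_nonneg (Real.sqrt_nonneg _) (Real.sqrt_nonneg _)) (by positivity)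
    have key : Real.sqrt ((((n x : ℝ)) ^ d)⁻¹) * Real.sqrt (∑ q ∈ Bll, f q ^ 2) ≤
        (Real.sqrt (Fintype.card Cp) * Real.exp (κ * (ρ₀ + 2 * d)) * Γ * (L : ℝ) ^ A * Real.sqrt (((L : ℝ) ^ A) ^ d) / m₀) *
          (n x : ℝ) ^ 2 * Real.exp (-((κ - (1 + d / 2) * t) * D)) * m := by
      calc Real.sqrt ((((n x : ℝ)) ^ d)⁻¹) * Real.sqrt (∑ q ∈ Bll, f q ^ 2)
          ≤ Real.sqrt ((((n x : ℝ)) ^ d)⁻¹) * (Real.exp (κ * (ρ₀ + 2 * d)) * Real.exp (-(κ * D)) *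
              (Γ * n x * S (lvl k') / m₀) * (Real.sqrt ((S (lvl k') : ℝ) ^ d * Fintype.card Cp) * m)) :=
            mul_le_mul_of_nonneg_left hB (Real.sqrt_nonneg _)
        _ = (Real.exp (κ * (ρ₀ + 2 * d)) * Real.exp (-(κ * D)) * Γ * n x / m₀ * m) *
              ((S (lvl k') : ℝ) * (Real.sqrt ((((n x : ℝ)) ^ d)⁻¹) * Real.sqrt (((S (lvl k') : ℝ)) ^ d * Fintype.card Cp))) := by
            ring
        _ ≤ (Real.exp (κ * (ρ₀ + 2 * d)) * Real.exp (-(κ * D)) * Γ * n x / m₀ * m) *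
              (((L : ℝ) ^ A * n x * Real.exp (t * D)) *
                (Real.sqrt (Fintype.card Cp) * Real.sqrt (((L : ℝ) ^ A) ^ d) * Real.exp (d / 2 * (t * D)))) :=
            mul_le_mul_of_nonneg_left step3 hpre0
        _ = (Real.sqrt (Fintype.card Cp) * Real.exp (κ * (ρ₀ + 2 * d)) * Γ * (L : ℝ) ^ A * Real.sqrt (((L : ℝ) ^ A) ^ d) / m₀) *
              (n x : ℝ) ^ 2 * (Real.exp (-(κ * D)) * Real.exp (t * D) * Real.exp (d / 2 * (t * D))) * m := by ring
        _ = _ := by rw [hexp2]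
    calc c₁ * Real.sqrt ((((n x : ℝ)) ^ d)⁻¹ * ∑ q ∈ Bll, f q ^ 2)
        = c₁ * (Real.sqrt ((((n x : ℝ)) ^ d)⁻¹) * Real.sqrt (∑ q ∈ Bll, f q ^ 2)) := by
          rw [Real.sqrt_mul (inv_nonneg.mpr (pow_nonneg hnx.le d))]
      _ ≤ c₁ * ((Real.sqrt (Fintype.card Cp) * Real.exp (κ * (ρ₀ + 2 * d)) * Γ * (L : ℝ) ^ A * Real.sqrt (((L : ℝ) ^ A) ^ d) / m₀) *
          (n x : ℝ) ^ 2 * Real.exp (-((κ - (1 + d / 2) * t) * D)) * m) := mul_le_mul_of_nonneg_left key hc₁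
      _ = _ := by ring
  have hκ' : 0 ≤ κ - (1 + d / 2) * t := by linarith [hrate]
  -- the second argument of the datum: `m′`
  by_cases hmeet : ∃ q ∈ Bll, cellOf S hS hdivS lvl zc hcover q.1 = k'
  · -- the ball meets the source cell: `m′ = m` and `D ≤ ρ₀ + 2d`
    obtain ⟨q₁, hq₁B, hq₁k⟩ := hmeet
    have hDle : D ≤ ρ₀ + 2 * d := by
      have hq₁' : sdist bsrc btgt n q₁.1 x ≤ ρ₀ := (mem_filter.mp hq₁B).2
      have h2d : sdist bsrc btgt n q₁.1 tk' ≤ 2 * d :=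
        (sdist_corner_thresholds S hS hdivS lvl zc hdisj hcover q₁.1 k').1 hq₁k
      have htri := sdist_triangle_torus n x q₁.1 tk'
      have hsym : sdist bsrc btgt n x q₁.1 = sdist bsrc btgt n q₁.1 x := sdist_comm bsrc btgt n x q₁.1
      rw [hD]; linarith
    have hm' : ∀ q : UT N × Cp, sdist bsrc btgt n q.1 x ≤ ρ₀ → |Aop f q| ≤ m := fun q hq => by
      rw [hAf q (hint q hq)]; exact hum q
    have hsecond : c₂ * (n x : ℝ) ^ 2 * m ≤
        c₂ * Real.exp ((κ - (1 + d / 2) * t) * (ρ₀ + 2 * d)) * (n x : ℝ) ^ 2 *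
          Real.exp (-((κ - (1 + d / 2) * t) * D)) * m := by
      have hprod : 0 ≤ (κ - (1 + d / 2) * t) * (ρ₀ + 2 * d - D) := mul_nonneg hκ' (by linarith)
      have hone : (1 : ℝ) ≤ Real.exp ((κ - (1 + d / 2) * t) * (ρ₀ + 2 * d)) * Real.exp (-((κ - (1 + d / 2) * t) * D)) := by
        rw [← Real.exp_add]
        refine Real.one_le_exp_iff.mpr ?_
        have heq : (κ - (1 + d / 2) * t) * (ρ₀ + 2 * d) + -((κ - (1 + d / 2) * t) * D) =
            (κ - (1 + d / 2) * t) * (ρ₀ + 2 * d - D) := by ring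
        rw [heq]; exact hprod
      have h0 : 0 ≤ c₂ * (n x : ℝ) ^ 2 * m := mul_nonneg (mul_nonneg hc₂ (sq_nonneg _)) hm
      have h1 := mul_le_mul_of_nonneg_left hone h0
      have heq2 : c₂ * (n x : ℝ) ^ 2 * m *
          (Real.exp ((κ - (1 + d / 2) * t) * (ρ₀ + 2 * d)) * Real.exp (-((κ - (1 + d / 2) * t) * D))) =
          c₂ * Real.exp ((κ - (1 + d / 2) * t) * (ρ₀ + 2 * d)) * (n x : ℝ) ^ 2 *
            Real.exp (-((κ - (1 + d / 2) * t) * D)) * m := by ring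
      rw [mul_one, heq2] at h1
      exact h1
    have hfin := add_le_add hfirst hsecond
    have hgoal : c₁ * (Real.sqrt (Fintype.card Cp) * Real.exp (κ * (ρ₀ + 2 * d)) * Γ * (L : ℝ) ^ A *
          Real.sqrt (((L : ℝ) ^ A) ^ d) / m₀) * (n x : ℝ) ^ 2 * Real.exp (-((κ - (1 + d / 2) * t) * D)) * m +
        c₂ * Real.exp ((κ - (1 + d / 2) * t) * (ρ₀ + 2 * d)) * (n x : ℝ) ^ 2 *
          Real.exp (-((κ - (1 + d / 2) * t) * D)) * m =
        (c₁ * (Real.sqrt (Fintype.card Cp) * Real.exp (κ * (ρ₀ + 2 * d)) * Γ * (L : ℝ) ^ A *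
          Real.sqrt (((L : ℝ) ^ A) ^ d) / m₀) + c₂ * Real.exp ((κ - (1 + d / 2) * t) * (ρ₀ + 2 * d))) *
          (n x : ℝ) ^ 2 * Real.exp (-((κ - (1 + d / 2) * t) * D)) * m := by ring
    rw [hgoal] at hfin
    exact (hregm hm').trans hfin
  · -- the ball misses the source cell: `m′ = 0`
    push Not at hmeet
    have hm' : ∀ q : UT N × Cp, sdist bsrc btgt n q.1 x ≤ ρ₀ → |Aop f q| ≤ 0 := by
      intro q hq
      rw [hAf q (hint q hq), hu q (hmeet q (mem_filter.mpr ⟨mem_univ _, hq⟩))]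
      simp
    have hsecond : 0 ≤
        c₂ * Real.exp ((κ - (1 + d / 2) * t) * (ρ₀ + 2 * d)) * (n x : ℝ) ^ 2 *
          Real.exp (-((κ - (1 + d / 2) * t) * D)) * m := by
      positivity
    have hfin := add_le_add hfirst hsecond
    have hgoal : c₁ * (Real.sqrt (Fintype.card Cp) * Real.exp (κ * (ρ₀ + 2 * d)) * Γ * (L : ℝ) ^ A *
          Real.sqrt (((L : ℝ) ^ A) ^ d) / m₀) * (n x : ℝ) ^ 2 * Real.exp (-((κ - (1 + d / 2) * t) * D)) * m +
        c₂ * Real.exp ((κ - (1 + d / 2) * t) * (ρ₀ + 2 * d)) * (n x : ℝ) ^ 2 *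
          Real.exp (-((κ - (1 + d / 2) * t) * D)) * m =
        (c₁ * (Real.sqrt (Fintype.card Cp) * Real.exp (κ * (ρ₀ + 2 * d)) * Γ * (L : ℝ) ^ A *
          Real.sqrt (((L : ℝ) ^ A) ^ d) / m₀) + c₂ * Real.exp ((κ - (1 + d / 2) * t) * (ρ₀ + 2 * d))) *
          (n x : ℝ) ^ 2 * Real.exp (-((κ - (1 + d / 2) * t) * D)) * m := by ring
    rw [hgoal] at hfin
    have h0 := hreg0 hm'
    rw [mul_zero] at h0
    exact h0.trans hfin

/-! ## §2 «17-Dirichlet»: the sup member for the Dirichlet inverses at interior points, NO binder -/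

/-- **THE SUP-NORM MEMBER (3.42)₁'s SHAPE FOR THE LOCAL DIRICHLET INVERSES AT INTERIOR POINTS — NO BINDER.**  As
`real_sup_dirInv_le_of_regularity` with a CONSTANT bond weight `c ≡ c₀ ≠ 0` and `hreg` DISCHARGED by the owner's file 17
`MultiscaleRegularityClosed.hreg_holds` (`ρ₀ = 4d+1`, `Γ = L^A e^{(log L/R)(4d+1)}`, `θ = 1/(4dΓ)`): for ANY {0,1}-valued `χ`, `u` supported
in cell `k′` with `|u| ≤ m`, and every `p = (x,i)` whose `d_n`-ball of radius `4d+1` lies in `{χ = 1}`: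
`|(G′u)(p)| ≤ 𝔅′·n(x)²·e^{−(κ − (1+d/2)log L/R)·d_n(x,t_{k′})}·m`, `𝔅′` = file 17's constant with `μ₀ ↦ min(μ₀,1)` in `K₁` — uniformly in the
domain; constants seeing `d, c₀, c_max, a_max, C, κ, L, A, R, |Cp|` ONLY.  NOT a bound on Bałaban's G′_□: the MODEL only.
[cite: Balaban1985BackgroundPropagators, Thm 3.1 (3.42) p.397 + (3.86)-(3.88) pp.408-409] [folklore] -/
theorem real_sup_dirInv_le {c₀ : ℝ} (hcc : ∀ b, c b = c₀) (hc₀ : c₀ ≠ 0)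
    (hμ : 0 < C - 2 * d * cmax ^ 2 * κ ^ 2 - amax * (Real.exp (2 * d * κ) - 1))
    {L : ℕ} (hL : 1 ≤ L) (e : J → ℕ) (hSe : ∀ l, S l = L ^ e l) {R : ℝ} (hR : 0 < R) {A : ℕ}
    (hadd : ∀ x y : UT N, |(e (lvl (cellOf S hS hdivS lvl zc hcover x)) : ℝ) - e (lvl (cellOf S hS hdivS lvl zc hcover y))| ≤
      A + sdist bsrc btgt (siteScale S hS hdivS lvl zc hcover) x y / R)
    (hrate : (1 + d / 2) * (Real.log L / R) ≤ κ)
    {Γ θ : ℝ} (hΓ : Γ = (L : ℝ) ^ A * Real.exp (Real.log L / R * (4 * d + 1))) (hθ : θ = 1 / (4 * d * Γ))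
    (χ : UT N × Cp → ℝ) (hχ : ∀ p, χ p = 0 ∨ χ p = 1)
    (k' : K) (u : UT N × Cp → ℝ) (hu : ∀ p, cellOf S hS hdivS lvl zc hcover p.1 ≠ k' → u p = 0)
    {m : ℝ} (hm : 0 ≤ m) (hum : ∀ p, |u p| ≤ m) (p : UT N × Cp)
    (hint : ∀ q : UT N × Cp, sdist bsrc btgt (siteScale S hS hdivS lvl zc hcover) q.1 p.1 ≤ 4 * d + 1 → χ q = 1) :
    |(dirInv (levelOp bsrc btgt c Rm (fun l x => ctrU N (S l) (tblk (hS l) (hdivS l) x))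
        (fun l x => ω l (ctrU N (S l) (tblk (hS l) (hdivS l) x))) T a) χ) u p| ≤
      ((max (Real.sqrt (11 ^ d)) (Cmv d * Real.sqrt (21 ^ d)) / Real.sqrt (θ ^ d) +
            Real.sqrt (Fintype.card Cp) * (θ + 1) ^ 2 * (amax * Γ ^ 2 * Real.sqrt (Γ ^ d)) / (2 * c₀ ^ 2)) *
          (Real.sqrt (Fintype.card Cp) * Real.exp (κ * ((4 * d + 1) + 2 * d)) *
            ((L : ℝ) ^ A * Real.exp (Real.log L / R * (4 * d + 1))) * (L : ℝ) ^ A * Real.sqrt (((L : ℝ) ^ A) ^ d) /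
            min (C - 2 * d * cmax ^ 2 * κ ^ 2 - amax * (Real.exp (2 * d * κ) - 1)) 1) +
          Real.sqrt (Fintype.card Cp) * (θ + 1) ^ 2 / (2 * c₀ ^ 2) *
            Real.exp ((κ - (1 + d / 2) * (Real.log L / R)) * ((4 * d + 1) + 2 * d))) *
        (siteScale S hS hdivS lvl zc hcover p.1 : ℝ) ^ 2 *
        Real.exp (-((κ - (1 + d / 2) * (Real.log L / R)) *
          sdist bsrc btgt (siteScale S hS hdivS lvl zc hcover) p.1 (ctrU N (S (lvl k')) (zc k')))) * m := by
  have hC1 : 0 ≤ max (Real.sqrt (11 ^ d)) (Cmv d * Real.sqrt (21 ^ d)) := le_max_of_le_left (Real.sqrt_nonneg _)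
  have hθ0 : 0 ≤ θ := by rw [hθ, hΓ]; positivity
  have hc₁ : 0 ≤ max (Real.sqrt (11 ^ d)) (Cmv d * Real.sqrt (21 ^ d)) / Real.sqrt (θ ^ d) +
      Real.sqrt (Fintype.card Cp) * (θ + 1) ^ 2 * (amax * Γ ^ 2 * Real.sqrt (Γ ^ d)) / (2 * c₀ ^ 2) := by
    rw [hΓ] at *; positivity
  have hc₂ : 0 ≤ Real.sqrt (Fintype.card Cp) * (θ + 1) ^ 2 / (2 * c₀ ^ 2) := by positivity
  exact real_sup_dirInv_le_of_regularity S hS hdivS lvl zc hdisj hcover Rm hRm T hT a ha ω hsupp hamax hscale c hc hcoer hκ0 hκ1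
    hμ hL e hSe hR hadd hrate hc₁ hc₂
    (hreg_holds S hS hdivS lvl zc hdisj hcover Rm hRm T hT a ha ω hsupp hamax hscale c hcc hc₀ hL e hSe hR hadd hΓ hθ)
    χ hχ k' u hu hm hum p hint

end

end Summit.QuantumFields.BalabanUV.Beta.MultiscaleSupMemberDirichlet
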